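import Summits.QuantumFields.YangMills.Theorems.LocalInsertionSublevelDoublingCover
import Summits.QuantumFields.YangMills.Theorems.LocalInsertionTorusUniformDoublingSU2D3
import Literature.MathematicalPhysics.QuantumFieldTheory.WilsonEnergyConvexity
import Literature.RepresentationTheory.CompactGroups.UnitaryTrick
import HarnessLib

/-!
# Sublevel doubling ⇒ ONE-SITE PARTITION-FUNCTION doubling at every temperature, every `d`; the γ-UNIFORM torus doubling on `(ℤ/L)³`

Crux `HistoryTailL` (stmt-QuantumFields-19936), level-0 lane (T4) «uniform doubling», row (T4-SUB), file 9 — the last link: the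
`{d : ℕ}`-generic port (literal `4 ↦ d`, proof verbatim) of the layer-cake bookkeeping of
`Theorems/LangevinControlUVFemtoCurvatureTwoPointCCornerOneSitePartitionDoubling.lean` (route `LangevinControlUV`, crux
`FemtoCurvatureTwoPointC`, input M1), fed with the d-generic sublevel doubling `sublevelDoubling` (`…SublevelDoublingCover`), and the
DISCHARGE of the displayed hypothesis `hONE` of `TorusUniformDoublingSU2D3.uniformDoubling_su2_d3_of_oneSiteDoubling` (✓, w4 g10):

* `OneSitePartition.partitionFunction_eq_layercake` — `Z(c) = ∫_{u>0} Haar^{⊗E}{u ≤ e^{−cS}} du` on `(ℤ/L)^d` (Mathlib's layer cake),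
  `OneSitePartition.setOf_le_exp_eq` — `{u ≤ e^{−cS}} = {S ≤ −log u/c}`;
* `OneSitePartition.partitionFunction_quarter_le` — on ANY torus `(ℤ/L)^d`: if `Haar^{⊗E}{S ≤ t} ≤ K·Haar^{⊗E}{S ≤ t/4}` for
  `0 < t ≤ t₀`, then for every `b > 0` `Z(b/4) ≤ (K + 1 + 1/Haar^{⊗E}{S ≤ t₀/4}) · Z(b)`;
* `partitionFunction_doubling` — for every compact `G`, lattice representation `r`, every `d`, `L`: ONE `K` with
  `Z_{d,L}(b/4) ≤ K·Z_{d,L}(b)` for ALL `b > 0` (UNCONDITIONAL: `sublevelDoubling` + the layer cake);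
* `oneSite_partitionFunction_doubling_su2_d3` — the `d = 3`, `L = 1`, `SU(2)`-fundamental instance, LETTER-EXACT the hypothesis `hONE`;
* ★ `uniformDoubling_su2_d3` — **the γ-UNIFORM doubling of the SU(2) Wilson partition function on `(ℤ/L)³`, UNCONDITIONAL**:
  `∃ A, ∀ L ≥ 2, b ≥ 4, Z_L(b/2) ≤ exp(A·L³)·Z_L(b)` := `uniformDoubling_su2_d3_of_oneSiteDoubling oneSite_partitionFunction_doubling_su2_d3`.
Rung R3 (continuum SU(2) YM₃ on T³) — not infinite volume, not a mass gap, not Clay; nothing of the stubs / the crux is proved here.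
Elementary; Mathlib + landed tree lemmas only; no named facts, no definitions.
-/

set_option autoImplicit false

noncomputable section

open scoped ENNReal NNReal
open MeasureTheory Set Literature.MathematicalPhysics.QuantumFieldTheory
open Literature.MathematicalPhysics.QuantumLattice (fundamentalRep fundamentalLatticeRep)

namespace Summit.QuantumFields.YangMills.Theorems.LocalInsertion.SublevelDoubling

namespace OneSitePartition

variable {G : Type*} [Group G] [TopologicalSpace G] [IsTopologicalGroup G] [CompactSpace G]
  [MeasurableSpace G] [BorelSpace G] {N : ℕ} (ρ : G →* Matrix (Fin N) (Fin N) ℂ)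

/-- **Layer-cake form of the partition function**: `Z(c) = ∫_{u > 0} Haar^{⊗E}{U | u ≤ e^{−c S(U)}} du`.
[folklore] -/
theorem partitionFunction_eq_layercake {d L : ℕ} [NeZero L] (hρ : Continuous ρ) (c : ℝ) :
    partitionFunction (d := d) (L := L) ρ c =
      ∫⁻ u in Ioi (0 : ℝ), (Measure.pi fun _ : Edge d L => haarProbability G)
        {U : GaugeConfig d L G | u ≤ Real.exp (-c * wilsonAction ρ U)} := by
  rw [show partitionFunction (d := d) (L := L) ρ c = ∫⁻ U, ENNReal.ofReal (Real.exp (-c * wilsonAction ρ U))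
      ∂(Measure.pi fun _ : Edge d L => haarProbability G) by
    simp only [partitionFunction, wilsonWeight, withDensity_apply _ MeasurableSet.univ, Measure.restrict_univ]]
  exact lintegral_eq_lintegral_meas_le _ (ae_of_all _ fun U => (Real.exp_pos _).le)
    (Real.measurable_exp.comp ((WilsonRP.measurable_wilsonAction ρ hρ).const_mul _)).aemeasurable

omit [TopologicalSpace G] [IsTopologicalGroup G] [CompactSpace G] [MeasurableSpace G] [BorelSpace G] in
/-- The layer-cake sets are sublevel sets of the action: `{u ≤ e^{−cS}} = {S ≤ −log u / c}` for
`u, c > 0`. [folklore] -/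
theorem setOf_le_exp_eq {d L : ℕ} [NeZero L] {u c : ℝ} (hu : 0 < u) (hc : 0 < c) :
    {U : GaugeConfig d L G | u ≤ Real.exp (-c * wilsonAction ρ U)} =
      {U : GaugeConfig d L G | wilsonAction ρ U ≤ -Real.log u / c} := by
  ext U
  simp only [mem_setOf_eq]
  rw [← Real.log_le_iff_le_exp hu, le_div_iff₀ hc]
  constructor <;> intro h <;> linarith

/-- **Sublevel doubling ⇒ partition-function doubling at EVERY temperature** on a fixed torus
`(ℤ/L)^d`: if `Haar^{⊗E}{S ≤ t} ≤ K · Haar^{⊗E}{S ≤ t/4}` for `0 < t ≤ t₀`, then for all `b > 0`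
`Z(b/4) ≤ (K + 1 + 1/Haar^{⊗E}{S ≤ t₀/4}) · Z(b)` (layer cake; one doubling step for `u ≥ e^{−bt₀/4}`;
the small-`u` range costs `e^{−bt₀/4} ≤ Z(b)/Haar^{⊗E}{S ≤ t₀/4}`). [folklore] -/
theorem partitionFunction_quarter_le {d L : ℕ} [NeZero L] (hρ : Continuous ρ)
    (hρN : ∀ g, (ρ g).trace.re ≤ N) {K : ℝ≥0} {t₀ : ℝ} (ht₀ : 0 < t₀)
    (hdbl : ∀ t : ℝ, 0 < t → t ≤ t₀ →
      Measure.pi (fun _ : Edge d L => haarProbability G)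
          {U : GaugeConfig d L G | wilsonAction ρ U ≤ t} ≤
        K * Measure.pi (fun _ : Edge d L => haarProbability G)
          {U : GaugeConfig d L G | wilsonAction ρ U ≤ t / 4})
    {b : ℝ} (hb : 0 < b) :
    (partitionFunction (d := d) (L := L) ρ (b / 4)).toReal ≤
      ((K : ℝ) + 1 + 1 / (Measure.pi fun _ : Edge d L => haarProbability G).real
          {U : GaugeConfig d L G | wilsonAction ρ U ≤ t₀ / 4}) *
        (partitionFunction (d := d) (L := L) ρ b).toReal := by
  set π : Measure (GaugeConfig d L G) := Measure.pi fun _ : Edge d L => haarProbability G with hπ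
  set a : ℝ := Real.exp (-(b * t₀ / 4)) with ha
  -- the layer-cake integrands
  set g : ℝ → ℝ → ℝ≥0∞ := fun c u =>
    π {U : GaugeConfig d L G | u ≤ Real.exp (-c * wilsonAction ρ U)} with hg
  -- (1) pointwise comparison on `u > 0`
  have hpt : ∀ u : ℝ, 0 < u →
      g (b / 4) u ≤ ((K : ℝ≥0∞) + 1) * g b u + (Iio a).indicator (1 : ℝ → ℝ≥0∞) u := by
    intro u hu
    by_cases hua : u < a
    · -- small `u`: the integrand is at most `1`
      have h1 : (Iio a).indicator (1 : ℝ → ℝ≥0∞) u = 1 := by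
        rw [indicator_of_mem (mem_Iio.2 hua), Pi.one_apply]
      rw [h1]
      exact (prob_le_one).trans le_add_self
    · replace hua : a ≤ u := not_lt.1 hua
      set t : ℝ := -Real.log u / b with ht
      have hb4 : 0 < b / 4 := by positivity
      have hset4 : {U : GaugeConfig d L G | u ≤ Real.exp (-(b / 4) * wilsonAction ρ U)} =
          {U : GaugeConfig d L G | wilsonAction ρ U ≤ 4 * t} := by
        rw [setOf_le_exp_eq ρ hu hb4, ht, div_div_eq_mul_div]
        ext U
        simp only [mem_setOf_eq]
        rw [show -Real.log u * 4 / b = 4 * (-Real.log u / b) by ring]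
      have hset1 : {U : GaugeConfig d L G | u ≤ Real.exp (-b * wilsonAction ρ U)} =
          {U : GaugeConfig d L G | wilsonAction ρ U ≤ t} := setOf_le_exp_eq ρ hu hb
      -- `a ≤ u` means `4t ≤ t₀`
      have h4t : 4 * t ≤ t₀ := by
        have hlog : -(b * t₀ / 4) ≤ Real.log u := by
          have h := Real.log_le_log (Real.exp_pos (-(b * t₀ / 4))) hua
          rwa [Real.log_exp] at h
        rw [ht, show 4 * (-Real.log u / b) = (-Real.log u) * 4 / b by ring, div_le_iff₀ hb]
        nlinarith
      have hmono : g (b / 4) u ≤ ((K : ℝ≥0∞) + 1) * g b u := by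
        show π {U : GaugeConfig d L G | u ≤ Real.exp (-(b / 4) * wilsonAction ρ U)} ≤
          ((K : ℝ≥0∞) + 1) * π {U : GaugeConfig d L G | u ≤ Real.exp (-b * wilsonAction ρ U)}
        rw [hset4, hset1]
        rcases le_or_gt t 0 with ht0 | ht0
        · calc π {U : GaugeConfig d L G | wilsonAction ρ U ≤ 4 * t}
              ≤ π {U : GaugeConfig d L G | wilsonAction ρ U ≤ t} :=
                measure_mono fun U (hU : wilsonAction ρ U ≤ 4 * t) =>
                  show wilsonAction ρ U ≤ t by linarith
            _ = 1 * π {U : GaugeConfig d L G | wilsonAction ρ U ≤ t} := (one_mul _).symm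
            _ ≤ ((K : ℝ≥0∞) + 1) * π {U : GaugeConfig d L G | wilsonAction ρ U ≤ t} :=
                mul_le_mul' le_add_self le_rfl
        · have h := hdbl (4 * t) (by positivity) h4t
          rw [show 4 * t / 4 = t by ring] at h
          calc π {U : GaugeConfig d L G | wilsonAction ρ U ≤ 4 * t}
              ≤ K * π {U : GaugeConfig d L G | wilsonAction ρ U ≤ t} := h
            _ ≤ ((K : ℝ≥0∞) + 1) * π {U : GaugeConfig d L G | wilsonAction ρ U ≤ t} :=
                mul_le_mul' le_self_add le_rfl
      exact hmono.trans le_self_add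
  -- (2) integrate over `u > 0`
  have hZ4 : partitionFunction (d := d) (L := L) ρ (b / 4) = ∫⁻ u in Ioi (0 : ℝ), g (b / 4) u :=
    partitionFunction_eq_layercake ρ hρ _
  have hZ1 : partitionFunction (d := d) (L := L) ρ b = ∫⁻ u in Ioi (0 : ℝ), g b u :=
    partitionFunction_eq_layercake ρ hρ _
  have hind : Measurable fun u : ℝ => (Iio a).indicator (1 : ℝ → ℝ≥0∞) u :=
    measurable_one.indicator measurableSet_Iio
  have hvol : ∫⁻ u in Ioi (0 : ℝ), (Iio a).indicator (1 : ℝ → ℝ≥0∞) u = ENNReal.ofReal a := by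
    rw [lintegral_indicator_one measurableSet_Iio, Measure.restrict_apply measurableSet_Iio,
      Iio_inter_Ioi, Real.volume_Ioo, sub_zero]
  have hK : ((K : ℝ≥0∞) + 1) ≠ ⊤ := by simp
  have hint : partitionFunction (d := d) (L := L) ρ (b / 4) ≤
      ((K : ℝ≥0∞) + 1) * partitionFunction (d := d) (L := L) ρ b + ENNReal.ofReal a := by
    rw [hZ4, hZ1, ← hvol, ← lintegral_const_mul' _ _ hK, ← lintegral_add_right _ hind]
    exact setLIntegral_mono' measurableSet_Ioi fun u hu => hpt u hu
  -- (3) back to real numbers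
  have hS0 : ∀ U : GaugeConfig d L G, 0 ≤ wilsonAction ρ U := fun U =>
    wilsonAction_nonneg_of_re_trace_le ρ hρN U
  have hZle : partitionFunction (d := d) (L := L) ρ b ≤ 1 := by
    rw [show partitionFunction (d := d) (L := L) ρ b = ∫⁻ U, ENNReal.ofReal (Real.exp (-b * wilsonAction ρ U)) ∂π by
      simp only [hπ, partitionFunction, wilsonWeight, withDensity_apply _ MeasurableSet.univ, Measure.restrict_univ]]
    calc _ ≤ ∫⁻ _U, (1 : ℝ≥0∞) ∂π := lintegral_mono fun U => by
            rw [← ENNReal.ofReal_one]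
            exact ENNReal.ofReal_le_ofReal (Real.exp_le_one_iff.2 (by nlinarith [hS0 U]))
      _ = 1 := by rw [lintegral_const, measure_univ, mul_one]
  have hZtop : partitionFunction (d := d) (L := L) ρ b ≠ ⊤ := ne_top_of_le_ne_top ENNReal.one_ne_top hZle
  have hRtop : ((K : ℝ≥0∞) + 1) * partitionFunction (d := d) (L := L) ρ b + ENNReal.ofReal a ≠ ⊤ :=
    ENNReal.add_ne_top.2 ⟨ENNReal.mul_ne_top hK hZtop, ENNReal.ofReal_ne_top⟩
  have ha0 : 0 ≤ a := (Real.exp_pos _).le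
  have hreal : (partitionFunction (d := d) (L := L) ρ (b / 4)).toReal ≤
      ((K : ℝ) + 1) * (partitionFunction (d := d) (L := L) ρ b).toReal + a := by
    have h := ENNReal.toReal_mono hRtop hint
    rw [ENNReal.toReal_add (ENNReal.mul_ne_top hK hZtop) ENNReal.ofReal_ne_top, ENNReal.toReal_mul,
      ENNReal.toReal_ofReal ha0, ENNReal.toReal_add ENNReal.coe_ne_top ENNReal.one_ne_top,
      ENNReal.coe_toReal, ENNReal.toReal_one] at h
    exact h
  -- (4) the small-`u` cost: `a ≤ Z(b) / Haar{S ≤ t₀/4}`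
  set p : ℝ := π.real {U : GaugeConfig d L G | wilsonAction ρ U ≤ t₀ / 4} with hp
  have hppos : 0 < p := measureReal_wilsonAction_le_pos ρ hρ (by positivity)
  have hlap : a * p ≤ (partitionFunction (d := d) (L := L) ρ b).toReal := by
    rw [partitionFunction_toReal_eq_integral ρ hρ b, ha, hp,
      show -(b * t₀ / 4) = -b * (t₀ / 4) by ring]
    exact exp_mul_measureReal_le_integral_exp ρ hρ hb.le (t₀ / 4)
  have hale : a ≤ (partitionFunction (d := d) (L := L) ρ b).toReal / p := by
    rwa [le_div_iff₀ hppos]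
  have hZ0 : 0 ≤ (partitionFunction (d := d) (L := L) ρ b).toReal := ENNReal.toReal_nonneg
  calc (partitionFunction (d := d) (L := L) ρ (b / 4)).toReal
      ≤ ((K : ℝ) + 1) * (partitionFunction (d := d) (L := L) ρ b).toReal +
          (partitionFunction (d := d) (L := L) ρ b).toReal / p := by linarith
    _ = ((K : ℝ) + 1 + 1 / p) * (partitionFunction (d := d) (L := L) ρ b).toReal := by ring

end OneSitePartition

/-- **Partition-function doubling at every temperature on every fixed torus `(ℤ/L)^d` — UNCONDITIONAL.** For every compact group `G`
(any Borel structure), lattice representation `r`, dimension `d` and side `L ≥ 1` there is ONE `K` with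
`Z(b/4) ≤ K · Z(b)` for ALL `b > 0`, `Z(b) = partitionFunction (d := d) (L := L) r.ρ b`: the d-generic sublevel doubling
`sublevelDoubling` through the layer cake `OneSitePartition.partitionFunction_quarter_le`. -/
theorem partitionFunction_doubling (G : Type) [Group G] [TopologicalSpace G] [IsTopologicalGroup G] [CompactSpace G]
    [MeasurableSpace G] [BorelSpace G] (r : LatticeRep G) (d L : ℕ) [NeZero L] :
    ∃ K : ℝ, ∀ b : ℝ, 0 < b →
      (partitionFunction (d := d) (L := L) r.ρ (b / 4)).toReal ≤ K * (partitionFunction (d := d) (L := L) r.ρ b).toReal := by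
  obtain ⟨K, t₀, ht₀, h⟩ := sublevelDoubling G r d L
  have hρN : ∀ g, (r.ρ g).trace.re ≤ r.N := fun g => by
    have h := Literature.RepresentationTheory.CompactGroups.CompactGroup.abs_re_trace_le_card r.ρ r.continuous g
    rw [Fintype.card_fin] at h
    exact (abs_le.1 h).2
  exact ⟨_, fun b hb => OneSitePartition.partitionFunction_quarter_le r.ρ r.continuous hρN ht₀ h hb⟩

/-- **One-site partition-function doubling for `SU(2)` on `G³` — LETTER-EXACT the displayed hypothesis `hONE` of
`TorusUniformDoublingSU2D3.uniformDoubling_su2_d3_of_oneSiteDoubling`:** `∃ K, ∀ t > 0, Z₁(t/4) ≤ K·Z₁(t)`,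
`Z₁(t) = partitionFunction (d := 3) (L := 1) (fundamentalRep (Fin 2)) t` (the three-link commutator integral over `SU(2)³`). -/
theorem oneSite_partitionFunction_doubling_su2_d3 :
    ∃ K : ℝ, ∀ t : ℝ, 0 < t →
      (partitionFunction (d := 3) (L := 1) (fundamentalRep (Fin 2)) (t / 4)).toReal ≤
        K * (partitionFunction (d := 3) (L := 1) (fundamentalRep (Fin 2)) t).toReal :=
  partitionFunction_doubling (Matrix.specialUnitaryGroup (Fin 2) ℂ) (fundamentalLatticeRep 2) 3 1

/-- ★ **The γ-UNIFORM DOUBLING of the `SU(2)` Wilson partition function on the 3-torus — UNCONDITIONAL.** There is `A` such that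
for every `L ≥ 2` and every `b ≥ 4`

  `Z_L(b/2) ≤ exp(A·L³) · Z_L(b)`,  `Z_L = partitionFunction (d := 3) (L := L) (fundamentalRep (Fin 2))`:

w4 g10's assembly `uniformDoubling_su2_d3_of_oneSiteDoubling` (holonomy-conditioned sandwich T4-UP + T4-LOW + antitone + `3L+2`
iterations of the one-site doubling) with its displayed hypothesis `hONE` discharged by `oneSite_partitionFunction_doubling_su2_d3`.
NO power of `b` survives — this is the input of the `b`- and `L`-uniform level-0 exponential plaquette moment (door at `λ = ½`). -/
theorem uniformDoubling_su2_d3 :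
    ∃ A : ℝ, ∀ (L : ℕ) [NeZero L] (b : ℝ), 2 ≤ L → 4 ≤ b →
      (partitionFunction (d := 3) (L := L) (fundamentalRep (Fin 2)) (b / 2)).toReal ≤
        Real.exp (A * (L : ℝ) ^ 3) * (partitionFunction (d := 3) (L := L) (fundamentalRep (Fin 2)) b).toReal :=
  TorusUniformDoublingSU2D3.uniformDoubling_su2_d3_of_oneSiteDoubling oneSite_partitionFunction_doubling_su2_d3

end Summit.QuantumFields.YangMills.Theorems.LocalInsertion.SublevelDoubling

end
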